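/-
Copyright (c) 2026 the pub-hodgecm-mathlib formalisation cell (harness21).  Prover seat hodgecm-mathlib-R90-C10-p08 (g2), SLAB R90-TF, section S1 «Ch. 10∕12 local»;
crux H413 = `stmt-HodgeConjecture-24833`; line (D-1) «B_pos at inert places» of U4Keys :182 (S1 A2′), card (B-10)(2) = census `R90/R90-C10-p08/g2/CENSUS-Bpos-ramified-posdepth.md` §5 (2) (R90-C10-plan (g2) DEALS
2026-09-05T00:05:09Z) (memo `R90/R90-C10-p05/g2/DESIGN-Bpos-inert.md` f70d293d60bf8a4b §2 (E5), §5).  KERNEL module: THEOREMS ONLY (no definition, no named fact, no `sorry`, no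
instance, no notation).  2026-09-05.
-/
import Summits.HodgeConjecture.HodgeConjecture.Theorems.R90S1BposCellCoverTwoDepthCM             -- ★ p863167 (R90-C10-p05 (g2)) (B-2b′): `cover_cells_twoDepth_CM`, `shellWitness_family` at a GENERAL two-depth group `J_e`, `e = (r₁, s₁; r₂, s₂)`, letters `(m, k, t, u₁, u₂)`; brings the (G3) frame and ★ p862990
import Summits.HodgeConjecture.HodgeConjecture.Theorems.R90S1BposCellCoverTwoDepthKZeroCM        -- ★ p863461 (this seat): `cells_cover_kZero` — the PLACE-FREE letter `hcells` at `e = (r₁, 0; r₂, 1)` (re-used by the ramified leaf; not restated here)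
import Literature.NumberTheory.Automorphic.NonsplitPlaceHaarBallRatios                           -- ★ `isUnit_toLocalRing_uniformizer`, `conjLocal_toLocalRing_uniformizer` (`ι_v ϖ_v` is a `σ`-fixed unit of `L ⊗ L⁺_v`)
import Literature.NumberTheory.Automorphic.HeisenbergLevelTwoChartRamified                        -- ★ `valued_toLocalRing_uniformizer_apply_of_ramified` (`|ι_vϖ_v|_w = exp(−2)`), `unitModulusChar_toLocalRing_uniformizer_of_ramified` (`‖ι_vϖ_v‖ = q⁻²`) at a TAME-RAMIFIED non-split place
import HarnessLib

/-!
# R90-TF S1 «Ch10-local» ∕ K2 E3 «U4Keys» :182, BRANCH B AT POSITIVE DEPTH — brick (B-10)(2): THE CELL LETTERS `hcells`, `hwit` OF ★ (B-0) AT THE FRAME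
# `e = (r₁, 0; r₂, 1)`, `k = 0`, AT A TAME-RAMIFIED PLACE, WITH THE TRACE-ONE AND THE F-WITNESS LETTERS DISCHARGED — the consumer surface of the ramified leaf
# [Rogawski1990 §1.10, §12.1–§12.2; Casselman1995 Prop. 1.3.1, §6.3; Roche1998 §3–§4; BruhatTits1972 (4.4.4), (6.4.9); Serre1979 Ch. V §2]

Cell `pub/hodgecm-mathlib`, crux H413 = `stmt-HodgeConjecture-24833`, route of record `HCCMUnconditional` (no route verbs); R90-TF section S1 (junction socket A2′
`stub_R90_122_keysThmTwo_ramifiedCharOne` = U4Keys :217, REL over :155 (★-closable) and :182 (OPEN)).  THEOREMS ONLY; lane `--supports stmt-HodgeConjecture-24833 --as helper`,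
count-neutral.  NOT THE PAYER of :182: consumed BY NAME by the RAMIFIED leaf `R90S1KeysThmTwoPosDepthBranchBRamifiedLeaf` (census §5 (8)) when it feeds ★ (B-0)
`R90S1BranchBDeterminantVanishingCells.det_intertwiningIntegral_eq_zero_of_typeVector_of_cells`.  The TAME-RAMIFIED TWIN of ★ p863461 `R90S1BposCellCoverTwoDepthKZeroCM` (inert: the
two discharges used `hunr`); the representation side of line (D-1) is place-generic (census §3), only these two discharges change.
WHAT.  ★ (B-2b′) p863167 (R90-C10-p05 (g2)) exports the two letters of ★ (B-0) at a GENERAL two-depth group `J_e`, `e = (r₁, s₁; r₂, s₂)`, over ★ p862990's letters `(m, k)`, a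
trace-one `t`, the E-witness `u₁` and a `σ`-fixed F-witness `u₂` at depth `k`.  At a TAME-RAMIFIED place (`he : e(w|v) ≠ 1`, `h2w : |2|_w = 1`) the ramified corner of line (D-1)
runs at the SAME exponents `(s₁, s₂) = (0, 1)`, `k = 0` (census §2 (b): hcondF holds at level `1` in both sub-branches `χ₁|_{𝒪_F^×} ∈ {1, ω|}`), and the two non-leaf letters are
DISCHARGED WITHOUT `hunr`: the trace-one `t := 2⁻¹` (`σ 2⁻¹ = 2⁻¹`, `2⁻¹ + 2⁻¹ = 1`, `|2⁻¹|_w = 1` by `h2w`), and the F-witness by the `k = 0` TRICK `u₂ := ι_v ϖ_v`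
(★ `isUnit_toLocalRing_uniformizer`; `σ`-fixed ★ `conjLocal_toLocalRing_uniformizer`; `|(ι_vϖ_v)_w − 1|_w ≤ 1 = |ϖ|⁰` from ★ `valued_toLocalRing_uniformizer_apply_of_ramified` (`= exp(−2)`);
`χ₁(ι_vϖ_v) ≠ 1` because `‖ι_vϖ_v‖ = q⁻² < 1` ★ `unitModulusChar_toLocalRing_uniformizer_of_ramified` and `hcontr`) — plus the exponent side conditions `hkm hss hr1 hs1 hs2 hal h10 h20`
from `r₁ + r₂ = m + 1`, `r₁ ≤ r₂ ≤ r₁ + 1`.  The exported statements are in ★ (B-0)'s EXACT binder shapes on the carrier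
`G = U(Φ₃)(L⁺_v)` (`H := (cmBorelTriple L 3 v).P`, `B := J_e`, `g₀ := w₀`, `θ := dite χ₁ (·)₀₀`, `τ :=` the record's `δ^{1∕2}·(χ₁, 1)`-line), with the representative family `R`
HYPOTHESIS-FIRST (letter `hR` = ★ p863167's set read on `U(Φ₃)(L⁺_v)`), so the leaf passes them with `exact` (no `show`, no carrier coercion on its side).
* §1 (no declaration) — the letter `hcells` is ★ p863461 `BposCellCoverTwoDepthKZeroCM.cells_cover_kZero` VERBATIM (place-free); the ramified leaf imports it from there.
* §2 **`cells_witness_kZero_ram`** — the letter `hwit` from EXACTLY the ramified leaf's letters: `he`, `h2w`, `χ₁`, `hcontr`, the conductor letter `hcond` at `m + 1`, the E-witness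
  `u₁` at depth `m` (★ `K2E3LocalCharacterConductorLetters.exists_conductor_letters`), and the exponents `(hm : 1 ≤ m) (hrr : r₁ + r₂ = m + 1) (hr12 : r₁ ≤ r₂) (hr21 : r₂ ≤ r₁ + 1)`.
HONEST LABEL.  HC_CM is proved only modulo the 7 printed citations (2 remaining named inputs: hLiu418 = `stmt-HodgeConjecture-24832`, h413 = `stmt-HodgeConjecture-24833`) until rung 0
closes; count-neutral — this file pays NO socket (:182 and A2′ stay OPEN); no printed citation is discharged.  Wild ramified places (`v ∣ 2`) are out of scope (census §6 (c)).

## References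
* [Rogawski1990] J. D. Rogawski, *Automorphic Representations of Unitary Groups in Three Variables*, Ann. of Math. Stud. 123 (1990), §1.10 p. 9; §12.1 p. 171; §12.2 (1)–(2) p. 173.
* [Casselman1995] W. Casselman, *Introduction to the theory of admissible representations of `p`-adic reductive groups* (1995), Prop. 1.3.1, §6.3.
* [Roche1998] A. Roche, *Types and Hecke algebras for principal series representations of split reductive p-adic groups*, Ann. Sci. ÉNS (4) 31 (1998), §3–§4.
* [BruhatTits1972] F. Bruhat, J. Tits, *Groupes réductifs sur un corps local I*, Publ. Math. IHÉS 41 (1972), (4.4.4), (6.4.9).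
* [Serre1979] J.-P. Serre, *Local Fields*, GTM 67 (1979), Ch. IV §1–§2 (tame ramification, `e = 2`).
* [NeukirchANT1999] J. Neukirch, *Algebraic Number Theory* (1999), Ch. II §6 (valuation of a uniformiser of the base at a ramified prime).
* [Keys1984] D. Keys, *Principal series representations of special unitary groups over local fields*, Compositio Math. 51 (1984), §7 Theorem (2) p. 126.
-/

set_option autoImplicit false
-- the mandated namespace has the single-problem summit's repeated segment (`HodgeConjecture.HodgeConjecture`)
set_option linter.dupNamespace false

noncomputable section

open NumberField IsDedekindDomain
open scoped Matrix MatrixGroups WithZero Valued NNReal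
open Literature.NumberTheory Literature.NumberTheory.Automorphic Literature.NumberTheory.Automorphic.UnitaryGroup
open Literature.NumberTheory.Rogawski1990

namespace Summit.HodgeConjecture.HodgeConjecture.R90.S1.BposRamCellCoverTwoDepthKZeroCM

open Summit.HodgeConjecture.HodgeConjecture.Cruxes.H413
open Summit.HodgeConjecture.HodgeConjecture.R90.S1

variable (L : Type) [Field L] [NumberField L] [IsCMField L] (v : HeightOneSpectrum (𝓞 ↥(maximalRealSubfield L)))
  (w : PlacesOver L v) (hw : IsCMField.complexConj L • w.1 = w.1)
  (eA : Gqs L v ≃ₜ* ↥(unitaryGroupOfForm (galAdicCompletionMap (L := L) (IsCMField.complexConj L) hw) ((StdForm.antidiagonal 3).over (w.1.adicCompletion L))))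
  (heA : ∀ g : Gqs L v,
    ((eA g : ↥(unitaryGroupOfForm (galAdicCompletionMap (L := L) (IsCMField.complexConj L) hw) ((StdForm.antidiagonal 3).over (w.1.adicCompletion L)))) :
        GL (Fin 3) (w.1.adicCompletion L)) =
      ((localNonsplitEquiv (IsCMField.complexConj L) (qsForm L) (IsCMField.complexConj_ne_one L) w hw g :
        ↥(unitaryGroupOfForm (galAdicCompletionMap (L := L) (IsCMField.complexConj L) hw) (placeForm (qsForm L) w.1))) : GL (Fin 3) (w.1.adicCompletion L)))
  {ϖ : w.1.adicCompletion L} (hϖ : Valued.v ϖ = WithZero.exp (-1 : ℤ))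
  (r₁ r₂ : ℕ) (Jg : Subgroup ↥(unitaryGroupOfForm (galAdicCompletionMap (L := L) (IsCMField.complexConj L) hw) ((StdForm.antidiagonal 3).over (w.1.adicCompletion L))))
  (hJg : ∀ k : ↥(unitaryGroupOfForm (galAdicCompletionMap (L := L) (IsCMField.complexConj L) hw) ((StdForm.antidiagonal 3).over (w.1.adicCompletion L))),
    k ∈ Jg ↔ ∀ i j, Valued.v (((k : GL (Fin 3) (w.1.adicCompletion L)) : Matrix (Fin 3) (Fin 3) (w.1.adicCompletion L)) i j) ≤
      Valued.v ϖ ^ (![![0, r₁, 0], ![r₂, 0, r₁], ![1, r₂, 0]] : Fin 3 → Fin 3 → ℕ) i j)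
  (Je : Subgroup (Gqs L v)) (hJe : Je = Jg.comap eA.toMulEquiv.toMonoidHom)
  (w₀ : ↥(unitaryGroupOfForm (conjLocal L (IsCMField.complexConj L) v) (cmLocalForm L 3 v))) (hw₀ : Units.val (w₀ : GL (Fin 3) (LocalRing L v)) = cmLocalForm L 3 v)
  (R : Set ↥(unitaryGroupOfForm (conjLocal L (IsCMField.complexConj L) v) (cmLocalForm L 3 v)))
  (hR : ∀ r : ↥(unitaryGroupOfForm (conjLocal L (IsCMField.complexConj L) v) (cmLocalForm L 3 v)), r ∈ R ↔
    r ∈ ((cmBorelTriple L 3 v).N).map (MulAut.conj w₀).toMonoidHom ∧ r ∉ Je ∧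
      ¬ (Valued.v ((((eA r : ↥(unitaryGroupOfForm (galAdicCompletionMap (L := L) (IsCMField.complexConj L) hw) ((StdForm.antidiagonal 3).over (w.1.adicCompletion L)))) : GL (Fin 3) (w.1.adicCompletion L)) : Matrix (Fin 3) (Fin 3) (w.1.adicCompletion L)) 2 1 /
            (((eA r : ↥(unitaryGroupOfForm (galAdicCompletionMap (L := L) (IsCMField.complexConj L) hw) ((StdForm.antidiagonal 3).over (w.1.adicCompletion L)))) : GL (Fin 3) (w.1.adicCompletion L)) : Matrix (Fin 3) (Fin 3) (w.1.adicCompletion L)) 2 0) ≤ Valued.v ϖ ^ r₁ ∧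
          (Valued.v ϖ ^ 0)⁻¹ ≤ Valued.v ((((eA r : ↥(unitaryGroupOfForm (galAdicCompletionMap (L := L) (IsCMField.complexConj L) hw) ((StdForm.antidiagonal 3).over (w.1.adicCompletion L)))) : GL (Fin 3) (w.1.adicCompletion L)) : Matrix (Fin 3) (Fin 3) (w.1.adicCompletion L)) 2 0)))

/-! ## §1 The letter `hcells` is PLACE-FREE: it is ★ p863461 `R90.S1.BposCellCoverTwoDepthKZeroCM.cells_cover_kZero` VERBATIM (same frame, same `R`, `hR`) — the ramified
leaf imports that module for `hcells` and this one for `hwit` (the gate's dedup lint forbids restating it here). -/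

/-! ## §2 The letter `hwit` at `e = (r₁, 0; r₂, 1)`, `k = 0`, at a tame-ramified place — trace-one and F-witness discharged -/

open Classical in
include hw heA hϖ hJg hJe hw₀ hR in
set_option maxHeartbeats 1600000 in
set_option synthInstance.maxHeartbeats 400000 in
-- class of ★ p862990 ∕ ★ p863167 (1600000): the `U(Φ₃)(L⁺_v)`-valued products are read in two definitionally equal carriers; unification is slow
/-- **THE LETTER `hwit` OF ★ (B-0) AT `e = (r₁, 0; r₂, 1)`, `k = 0`, AT A TAME-RAMIFIED PLACE, FROM THE LEAF's LETTERS.**  `v` non-split, RAMIFIED in `L` (`he`), `|2|_w = 1`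
(`h2w`); `χ₁ : (L ⊗ L⁺_v)ˣ → ℂˣ` contracting
(`hcontr`) with conductor letter `hcond` at `m + 1` (`χ₁ = 1` on `{∀ w′, |u_{w′} − 1| ≤ |ϖ|^{m+1}}`, `1 ≤ m`) and E-witness `u₁` (`|(u₁)_{w′} − 1| ≤ |ϖ|ᵐ`, `χ₁ u₁ ≠ 1`); exponents
`r₁ + r₂ = m + 1`, `r₁ ≤ r₂ ≤ r₁ + 1`.  Then every `r ∈ R` is `θ`-IRRELEVANT: there is `b₀ ∈ J_e` with `r b₀ r⁻¹ ∈ P` and `θ(b₀) ≠ τ(r b₀ r⁻¹)·1`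
(`θ(g) = if IsUnit g₀₀ then χ₁(unit g₀₀) else 0`, `τ = ((1 ⊗ (χ₁, 1)) ∘ proj) ⊗ δ^{1∕2}`).  Proof: ★ p863167 `shellWitness_family` at `(s₁, s₂, k) := (0, 1, 0)` with `t := 2⁻¹`
(`h2w`) and `u₂ := ι_v ϖ_v` (`σ`-fixed; `|(ι_vϖ_v)_w| = exp(−2) ≤ 1` ★ `valued_toLocalRing_uniformizer_apply_of_ramified`; `χ₁(ι_vϖ_v) ≠ 1` from `‖ι_vϖ_v‖ = q⁻² < 1` ★
`unitModulusChar_toLocalRing_uniformizer_of_ramified` and `hcontr`); `hr1 hs1 hs2 hal h10 h20` by arithmetic. [cite: Roche1998, §3–§4] [cite: Casselman1995, §6.3]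
[cite: Rogawski1990, §12.1 p. 171, §12.2 (1)–(2) p. 173] [cite: BruhatTits1972, (6.4.9)] [cite: Serre1979, Ch. IV §1–§2] [cite: NeukirchANT1999, Ch. II §6]
[cite: Keys1984, §7 Theorem (2) p. 126] -/
theorem cells_witness_kZero_ram {m : ℕ} (hm : 1 ≤ m) (hrr : r₁ + r₂ = m + 1) (hr12 : r₁ ≤ r₂) (hr21 : r₂ ≤ r₁ + 1)
    (he : v.asIdeal.ramificationIdx' w.1.asIdeal ≠ 1) (h2w : Valued.v (2 : w.1.adicCompletion L) = 1)
    (χ₁ : (LocalRing L v)ˣ →* ℂˣ)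
    (hcontr : ∀ x : (LocalRing L v)ˣ, unitModulusChar (LocalRing L v) x < 1 → ‖((χ₁ x : ℂˣ) : ℂ)‖ < 1)
    (hcond : ∀ u : (LocalRing L v)ˣ, (∀ w' : PlacesOver L v, Valued.v (((u : LocalRing L v) w') - 1) ≤ Valued.v ϖ ^ (m + 1)) → χ₁ u = 1)
    (u₁ : (LocalRing L v)ˣ) (hu₁ : ∀ w' : PlacesOver L v, Valued.v (((u₁ : LocalRing L v) w') - 1) ≤ Valued.v ϖ ^ m) (hχu₁ : χ₁ u₁ ≠ 1) :
    ∀ r ∈ R, ∃ b₀ : ↥(unitaryGroupOfForm (conjLocal L (IsCMField.complexConj L) v) (cmLocalForm L 3 v)), b₀ ∈ Je ∧ ∃ hb₀P : r * b₀ * r⁻¹ ∈ (cmBorelTriple L 3 v).P,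
      (if h : IsUnit (((b₀ : GL (Fin 3) (LocalRing L v)) : Matrix (Fin 3) (Fin 3) (LocalRing L v)) 0 0) then ((χ₁ h.unit : ℂˣ) : ℂ) else 0) ≠
        (haveI := locallyCompactSpace_cmBorelU L 3 v
         (Representation.twist
            (((Representation.trivial ℂ ↥(torusU (conjLocal L (IsCMField.complexConj L) v) (cmLocalForm L 3 v)) ℂ).twist
              (cmTorusCharPair L v χ₁ 1)).comp (cmBorelTriple L 3 v).proj) (rootDeltaChar (cmBorelTriple L 3 v).P))
          ⟨r * b₀ * r⁻¹, hb₀P⟩ 1) := by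
  intro r hr
  haveI := locallyCompactSpace_cmBorelU L 3 v
  obtain ⟨hrN, hoff, hshal⟩ := (hR r).1 hr
  -- the trace-one letter at a tame place: `t := 2⁻¹`
  have ht : (2⁻¹ : w.1.adicCompletion L) + galAdicCompletionMap (L := L) (IsCMField.complexConj L) hw 2⁻¹ = 1 := by
    rw [map_inv₀, map_ofNat, ← two_mul, mul_inv_cancel₀ two_ne_zero]
  have hvt : Valued.v (2⁻¹ : w.1.adicCompletion L) ≤ 1 := by rw [map_inv₀, h2w, inv_one]
  -- the F-witness at depth `k = 0`: `u₂ := ι_v ϖ_v` (one place `w ∣ v` over a non-split `v`)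
  have hσϖ : Units.map (conjLocal L (IsCMField.complexConj L) v : LocalRing L v →* LocalRing L v) (isUnit_toLocalRing_uniformizer L v).unit =
      (isUnit_toLocalRing_uniformizer L v).unit :=
    Units.ext (by rw [Units.coe_map, MonoidHom.coe_coe]; exact conjLocal_toLocalRing_uniformizer L v)
  have hϖ0 : ∀ w' : PlacesOver L v, Valued.v ((((isUnit_toLocalRing_uniformizer L v).unit : (LocalRing L v)ˣ) : LocalRing L v) w' - 1) ≤ Valued.v ϖ ^ 0 := fun w' => by
    obtain rfl := (PlacesOver.eq_of_smul_eq (IsCMField.complexConj L) (IsCMField.complexConj_ne_one L) w hw w').symm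
    rw [pow_zero]
    refine (Valuation.map_sub _ _ _).trans (max_le ?_ (by rw [Valuation.map_one]))
    rw [valued_toLocalRing_uniformizer_apply_of_ramified L v w hw he, ← WithZero.exp_zero, WithZero.exp_le_exp]
    norm_num
  have hχϖ : χ₁ (isUnit_toLocalRing_uniformizer L v).unit ≠ 1 := fun h1 => by
    have hq : (1 : ℝ≥0) < (Ideal.absNorm v.asIdeal : ℝ≥0) := by exact_mod_cast NumberField.HeightOneSpectrum.one_lt_absNorm v
    have hlt : ‖((χ₁ (isUnit_toLocalRing_uniformizer L v).unit : ℂˣ) : ℂ)‖ < 1 := hcontr _ (by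
      rw [unitModulusChar_toLocalRing_uniformizer_of_ramified L v w hw he]
      exact inv_lt_one_of_one_lt₀ (one_lt_pow₀ hq two_ne_zero))
    rw [h1, Units.val_one, norm_one] at hlt
    exact lt_irrefl _ hlt
  -- ★ p863167 at `(s₁, s₂, k) := (0, 1, 0)`, read back on the carrier `U(Φ₃)(L⁺_v)`
  obtain ⟨b₀, hb₀J, hb₀P, hne⟩ := BposCellCoverTwoDepthCM.shellWitness_family L v w hw eA heA hϖ r₁ 0 r₂ 1 Jg hJg Je hJe w₀ hw₀
    hm (Nat.zero_le m) hrr rfl (by omega) hr21 (by omega) (by omega) (Or.inl ⟨hr12, Nat.zero_le 1⟩) (by omega) le_rfl ht hvt χ₁ hcond u₁ hu₁ hχu₁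
    (isUnit_toLocalRing_uniformizer L v).unit hσϖ hϖ0 hχϖ r ⟨hrN, hoff, hshal⟩
  exact ⟨b₀, hb₀J, hb₀P, hne⟩

end Summit.HodgeConjecture.HodgeConjecture.R90.S1.BposRamCellCoverTwoDepthKZeroCM

end
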